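import Literature.NumberTheory.Transcendental.RoySmallValueEstimates
import Mathlib.Analysis.SpecialFunctions.Pow.Real
import Mathlib.Analysis.SpecialFunctions.Pow.Continuity
import Mathlib.Analysis.SpecialFunctions.Log.Basic
import Mathlib.Topology.Algebra.Order.Field
import Mathlib.Topology.Order.OrderClosed
import HarnessLib

/-!
# Small value estimates at rational translates (Nguyen–Roy 2016) — proofs: the reduction to `|s| > 1` (Lemma 3)

Proofs file towards `Literature.NumberTheory.Transcendental.nguyenRoy2016_thm_1` (Nguyen–Roy,
*A small value estimate in dimension two involving translations by rational points*, IJNT 12 (2016)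
= arXiv:1412.5163, Theorem 1). Everything here is PROVED; two auxiliary definitions with bodies
(`revExp`, `revX2`: the polynomial `X₂^N P(X₁, X₂⁻¹)`), no named facts.

**Lemma 3** of the paper: *"Suppose that Theorem 1 holds when `|s| > 1`. Then it holds in
general."* Printed proof: if `|s| < 1`, choose `ε > 0` so that condition (1) still holds with `ν`
replaced by `ν − ε`; the polynomial `P̃_D = X₂^{⌊D/2⌋} P_{⌊D/2⌋}(X₁, X₂⁻¹)` belongs to `ℤ[X₁, X₂]`,
has degree `≤ D`, norm `≤ e^{⌊D/2⌋^β} ≤ e^{D^β}` and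
`|P̃_D(ξ + ir, η⁻¹s⁻ⁱ)| ≤ (|η|⁻¹|s|⁻ⁱ)^{⌊D/2⌋} e^{−⌊D/2⌋^ν} ≤ e^{−D^{ν−ε}}` "for `0 ≤ i < 4⌊D^σ⌋`";
since `|s⁻¹| > 1`, `ξ` and `η⁻¹` are algebraic, hence `η` too.

**Scope caveat (a gap in the printed argument).** The hypothesis on `P_{⌊D/2⌋}` controls its
values only for `0 ≤ i < 4⌊⌊D/2⌋^σ⌋`, not for `0 ≤ i < 4⌊D^σ⌋` as used in the display: the
halving of the degree index loses a factor `2^σ` in the number of points. The argument is repaired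
by lowering `σ` as well: for ANY `σ' < σ` and `ν' < ν` (with `1 + σ' < ν'`), the hypotheses of
Theorem 1 at `(ξ, η, r, s; σ, β, ν)` with `|s| < 1` imply those at `(ξ, η⁻¹, r, s⁻¹; σ', β, ν')`
(`smallValue_hyp_inv`), and condition (1) is open in `(σ, ν)` when `σ > 1`
(`exists_smaller_params`). Consequently **Theorem 1 for `|s| > 1` implies Theorem 1 for all
`s ∈ ℚ ∖ {0, ±1}` in the range `1 < σ < 2`** (`thm1_of_one_lt_abs`); the boundary case `σ = 1`
with `|s| < 1` is NOT covered by this reduction (it needs the case `|s| > 1` with the point count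
`4⌊D^σ⌋` relaxed to `⌊c D^σ⌋` for some `c < 4`, which the proof of the paper allows since every
use of the point count is asymptotic in `D`).

* `revX2 N P = X₂^N P(X₁, X₂⁻¹)` for `P ∈ ℤ[X₁, X₂]` of degree `≤ N`: non-zero, of degree
  `≤ 2N`, of height `≤ ‖P‖`, with `revX2 N P (x, y) = y^N P(x, y⁻¹)` (`aeval_revX2`);
* `smallValue_hyp_inv` — the transfer of the hypothesis of Theorem 1 (the repaired display);
* `exists_smaller_params` — openness of condition (1) for `σ > 1`;
* `thm1_of_one_lt_abs` — Lemma 3 for `1 < σ < 2`.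

## References

* [NguyenRoy2016] N. A. V. Nguyen, D. Roy, IJNT 12 (2016) 1273–1293 = arXiv:1412.5163, §2,
  Lemma 3 and its proof; Theorem 1 and condition (1).
-/

noncomputable section

open MvPolynomial Filter Finset
open _root_.Topology

namespace Literature.NumberTheory.Transcendental

namespace NguyenRoy

/-! ### The polynomial `X₂^N P(X₁, X₂⁻¹)` -/

/-- The exponent `(a, N − b)` of `X₁^a X₂^{N−b}`, image of `(a, b)`. [cite: NguyenRoy2016, proof of Lemma 3] -/
def revExp (N : ℕ) (d : Fin 2 →₀ ℕ) : Fin 2 →₀ ℕ :=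
  Finsupp.single 0 (d 0) + Finsupp.single 1 (N - d 1)

/-- `(a, N − b)₀ = a`. [folklore] -/
@[simp] theorem revExp_zero (N : ℕ) (d : Fin 2 →₀ ℕ) : revExp N d 0 = d 0 := by simp [revExp]

/-- `(a, N − b)₁ = N − b`. [folklore] -/
@[simp] theorem revExp_one (N : ℕ) (d : Fin 2 →₀ ℕ) : revExp N d 1 = N - d 1 := by simp [revExp]

/-- `revExp N` is injective on exponents with `b ≤ N`. [folklore] -/
theorem revExp_inj {N : ℕ} {d d' : Fin 2 →₀ ℕ} (hd : d 1 ≤ N) (hd' : d' 1 ≤ N)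
    (h : revExp N d = revExp N d') : d = d' := by
  have h0 := congrArg (fun e : Fin 2 →₀ ℕ => e 0) h
  have h1 := congrArg (fun e : Fin 2 →₀ ℕ => e 1) h
  simp only [revExp_zero, revExp_one] at h0 h1
  ext k
  fin_cases k
  · exact h0
  · show d 1 = d' 1
    omega

/-- `X₂^N P(X₁, X₂⁻¹) = ∑ c_{ab} X₁^a X₂^{N−b}` for `P = ∑ c_{ab} X₁^a X₂^b` of degree `≤ N`.
[cite: NguyenRoy2016, proof of Lemma 3 (the polynomial P̃_D)] -/
def revX2 (N : ℕ) (P : MvPolynomial (Fin 2) ℤ) : MvPolynomial (Fin 2) ℤ :=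
  ∑ d ∈ P.support, monomial (revExp N d) (coeff d P)

/-- Exponents of `P` have `b ≤ a + b ≤ deg P`. [folklore] -/
theorem apply_one_le_of_mem_support {N : ℕ} {P : MvPolynomial (Fin 2) ℤ} (hP : P.totalDegree ≤ N)
    {d : Fin 2 →₀ ℕ} (hd : d ∈ P.support) : d 0 + d 1 ≤ N := by
  have h := le_totalDegree hd
  rw [Finsupp.sum_fintype _ _ (fun _ => rfl), Fin.sum_univ_two] at h
  exact h.trans hP

/-- The coefficients of `revX2 N P` at the images of the exponents of `P`. [folklore] -/
theorem coeff_revX2 {N : ℕ} {P : MvPolynomial (Fin 2) ℤ} (hP : P.totalDegree ≤ N)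
    {d : Fin 2 →₀ ℕ} (hd : d ∈ P.support) : coeff (revExp N d) (revX2 N P) = coeff d P := by
  classical
  rw [revX2, coeff_sum]
  simp_rw [coeff_monomial]
  rw [Finset.sum_eq_single d]
  · rw [if_pos rfl]
  · intro d' hd' hne
    rw [if_neg]
    intro h
    have h1 := apply_one_le_of_mem_support hP hd'
    have h2 := apply_one_le_of_mem_support hP hd
    exact hne (revExp_inj (by omega) (by omega) h)
  · intro h
    exact absurd hd h

/-- The other coefficients of `revX2 N P` vanish. [folklore] -/
theorem coeff_revX2_eq_zero {N : ℕ} {P : MvPolynomial (Fin 2) ℤ} {m : Fin 2 →₀ ℕ}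
    (hm : ∀ d ∈ P.support, revExp N d ≠ m) : coeff m (revX2 N P) = 0 := by
  classical
  rw [revX2, coeff_sum]
  exact Finset.sum_eq_zero fun d hd => by rw [coeff_monomial, if_neg (hm d hd)]

/-- The support of `revX2 N P` is contained in the image of the support of `P`. [folklore] -/
theorem support_revX2_subset {N : ℕ} (P : MvPolynomial (Fin 2) ℤ) [DecidableEq (Fin 2 →₀ ℕ)] :
    (revX2 N P).support ⊆ P.support.image (revExp N) := by
  intro m hm
  by_contra h
  apply mem_support_iff.mp hm
  exact coeff_revX2_eq_zero fun d hd heq => h (Finset.mem_image.mpr ⟨d, hd, heq⟩)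

/-- `revX2 N P ≠ 0` for `P ≠ 0` of degree `≤ N`. [cite: NguyenRoy2016, proof of Lemma 3] -/
theorem revX2_ne_zero {N : ℕ} {P : MvPolynomial (Fin 2) ℤ} (hP : P.totalDegree ≤ N) (h0 : P ≠ 0) :
    revX2 N P ≠ 0 := by
  obtain ⟨d, hd⟩ := support_nonempty.mpr h0
  intro h
  have hc := coeff_revX2 hP hd
  rw [h, coeff_zero] at hc
  exact (mem_support_iff.mp hd) hc.symm

/-- `deg revX2 N P ≤ 2N` ("has degree at most `D`" for `N = ⌊D/2⌋`). [cite: NguyenRoy2016, proof of Lemma 3] -/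
theorem totalDegree_revX2_le {N : ℕ} {P : MvPolynomial (Fin 2) ℤ} (hP : P.totalDegree ≤ N) :
    (revX2 N P).totalDegree ≤ 2 * N := by
  rw [revX2]
  refine (totalDegree_finsetSum _ _).trans (Finset.sup_le fun d hd => ?_)
  refine (totalDegree_monomial_le _ _).trans ?_
  rw [Finsupp.sum_fintype _ _ (fun _ => rfl), Fin.sum_univ_two]
  simp only [id, revExp_zero, revExp_one]
  have h := apply_one_le_of_mem_support hP hd
  omega

/-- `‖revX2 N P‖ ≤ ‖P‖` (the coefficients are the same). [cite: NguyenRoy2016, proof of Lemma 3 ("norm at most e^{⌊D/2⌋^β}")] -/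
theorem mvPolyHeight_revX2_le {N : ℕ} {P : MvPolynomial (Fin 2) ℤ} (hP : P.totalDegree ≤ N) :
    mvPolyHeight (revX2 N P) ≤ mvPolyHeight P := by
  classical
  unfold mvPolyHeight
  refine Finset.sup_le fun m hm => ?_
  obtain ⟨d, hd, rfl⟩ := Finset.mem_image.mp (support_revX2_subset P hm)
  rw [coeff_revX2 hP hd]
  exact Finset.le_sup (f := fun m => (P.coeff m).natAbs) hd

/-- **`revX2 N P (x, y) = y^N P(x, y⁻¹)`** for `y ≠ 0`. [cite: NguyenRoy2016, proof of Lemma 3] -/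
theorem aeval_revX2 {N : ℕ} {P : MvPolynomial (Fin 2) ℤ} (hP : P.totalDegree ≤ N) (x y : ℂ)
    (hy : y ≠ 0) : aeval ![x, y] (revX2 N P) = y ^ N * aeval ![x, y⁻¹] P := by
  rw [revX2, map_sum]
  conv_rhs => rw [P.as_sum, map_sum, Finset.mul_sum]
  refine Finset.sum_congr rfl fun d hd => ?_
  rw [aeval_monomial, aeval_monomial, Finsupp.prod_fintype _ _ (fun _ => by rw [pow_zero]),
    Finsupp.prod_fintype _ _ (fun _ => by rw [pow_zero]), Fin.prod_univ_two, Fin.prod_univ_two]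
  simp only [revExp_zero, revExp_one, Matrix.cons_val_zero, Matrix.cons_val_one]
  have h1 : d 1 ≤ N := by have := apply_one_le_of_mem_support hP hd; omega
  rw [inv_pow, pow_sub₀ y hy h1]
  ring

/-! ### Thresholds -/

/-- For `a < b`, `ε > 0` and any `c`: `c D^a ≤ ε D^b` for all large integers `D`. [folklore] -/
theorem eventually_mul_rpow_le_mul_rpow (c : ℝ) {a b ε : ℝ} (hab : a < b) (hε : 0 < ε) :
    ∀ᶠ D : ℕ in atTop, c * (D : ℝ) ^ a ≤ ε * (D : ℝ) ^ b := by
  have h2 : Tendsto (fun D : ℕ => (D : ℝ) ^ (b - a)) atTop atTop :=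
    (tendsto_rpow_atTop (by linarith)).comp tendsto_natCast_atTop_atTop
  filter_upwards [h2.eventually_ge_atTop (c / ε), eventually_gt_atTop 0] with D hD hD0
  have hDpos : (0 : ℝ) < D := by exact_mod_cast hD0
  calc c * (D : ℝ) ^ a ≤ (ε * (D : ℝ) ^ (b - a)) * (D : ℝ) ^ a := by
        refine mul_le_mul_of_nonneg_right ?_ (Real.rpow_nonneg hDpos.le _)
        rwa [← div_le_iff₀' hε]
    _ = ε * (D : ℝ) ^ b := by rw [mul_assoc, ← Real.rpow_add hDpos, sub_add_cancel]

/-! ### The transfer of the hypothesis (proof of Lemma 3, repaired) -/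

/-- **The hypothesis of Theorem 1 passes from `(ξ, η, r, s; σ, β, ν)` with `|s| < 1` to
`(ξ, η⁻¹, r, s⁻¹; σ', β, ν')`** for any `0 ≤ σ' < σ`, `ν' < ν` with `1 + σ' < ν'` (`β ≥ 0`): with
`N = ⌊D/2⌋` and `P̃_D = X₂^N P_N(X₁, X₂⁻¹)` one has `P̃_D ≠ 0`, `deg P̃_D ≤ D`, `‖P̃_D‖ ≤ e^{D^β}` and
`|P̃_D(ξ + ir, η⁻¹s⁻ⁱ)| = (|η|⁻¹|s|⁻ⁱ)^N |P_N(ξ + ir, ηsⁱ)| ≤ e^{N(A + 4BD^{σ'}) − N^ν} ≤ e^{−D^{ν'}}`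
for `0 ≤ i < 4⌊D^{σ'}⌋ ≤ 4⌊N^σ⌋` and `D` large (`A = |log|η||`, `B = −log|s| > 0`).
[cite: NguyenRoy2016, Lemma 3 (proof, with σ also lowered — see the module docstring)] -/
theorem smallValue_hyp_inv {ξ η : ℂ} (hη : η ≠ 0) {r s : ℚ} (hs0 : s ≠ 0) (hs1 : |s| < 1)
    {σ β ν σ' ν' : ℝ} (hσ'0 : 0 ≤ σ') (hσ' : σ' < σ) (hβ : 0 ≤ β) (hν'1 : 1 + σ' < ν')
    (hν' : ν' < ν)
    (H : ∀ᶠ D : ℕ in atTop, ∃ P : MvPolynomial (Fin 2) ℤ, P ≠ 0 ∧ P.totalDegree ≤ D ∧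
      (mvPolyHeight P : ℝ) ≤ Real.exp ((D : ℝ) ^ β) ∧
      ∀ i : ℕ, i < 4 * ⌊(D : ℝ) ^ σ⌋₊ →
        ‖aeval ![ξ + (i : ℂ) * (r : ℂ), η * (s : ℂ) ^ i] P‖ ≤ Real.exp (-(D : ℝ) ^ ν)) :
    ∀ᶠ D : ℕ in atTop, ∃ P : MvPolynomial (Fin 2) ℤ, P ≠ 0 ∧ P.totalDegree ≤ D ∧
      (mvPolyHeight P : ℝ) ≤ Real.exp ((D : ℝ) ^ β) ∧
      ∀ i : ℕ, i < 4 * ⌊(D : ℝ) ^ σ'⌋₊ →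
        ‖aeval ![ξ + (i : ℂ) * (r : ℂ), η⁻¹ * ((s⁻¹ : ℚ) : ℂ) ^ i] P‖ ≤
          Real.exp (-(D : ℝ) ^ ν') := by
  -- the hypothesis at level `⌊D/2⌋`
  have hdiv : Tendsto (fun D : ℕ => D / 2) atTop atTop :=
    Filter.tendsto_atTop_atTop.mpr fun b => ⟨2 * b, fun D hD => by omega⟩
  have H2 := hdiv.eventually H
  -- constants
  have hs0' : (s : ℂ) ≠ 0 := by exact_mod_cast hs0
  have hsn : ‖(s : ℂ)‖ = |(s : ℝ)| := by
    rw [← Complex.ofReal_ratCast, Complex.norm_real, Real.norm_eq_abs]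
  have hsabs : |(s : ℝ)| < 1 := by exact_mod_cast hs1
  have hsabs0 : 0 < |(s : ℝ)| := abs_pos.mpr (by exact_mod_cast hs0)
  set A : ℝ := |Real.log ‖η‖| with hA
  set B : ℝ := -Real.log |(s : ℝ)| with hB
  have hB0 : 0 < B := by rw [hB, neg_pos]; exact Real.log_neg hsabs0 hsabs
  have hA0 : 0 ≤ A := abs_nonneg _
  -- thresholds
  have hν0 : 0 < ν := by linarith
  have E1 : ∀ᶠ D : ℕ in atTop, (3 : ℝ) ^ σ * (D : ℝ) ^ σ' ≤ 1 * (D : ℝ) ^ σ :=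
    eventually_mul_rpow_le_mul_rpow _ hσ' one_pos
  have hε : (0 : ℝ) < 1 / 3 ^ (ν + 1) := by positivity
  have E2 : ∀ᶠ D : ℕ in atTop, A * (D : ℝ) ^ (1 : ℝ) ≤ 1 / 3 ^ (ν + 1) * (D : ℝ) ^ ν :=
    eventually_mul_rpow_le_mul_rpow _ (by linarith) hε
  have E3 : ∀ᶠ D : ℕ in atTop, 4 * B * (D : ℝ) ^ (1 + σ') ≤ 1 / 3 ^ (ν + 1) * (D : ℝ) ^ ν :=
    eventually_mul_rpow_le_mul_rpow _ (by linarith) hε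
  have E4 : ∀ᶠ D : ℕ in atTop, 1 * (D : ℝ) ^ ν' ≤ 1 / 3 ^ (ν + 1) * (D : ℝ) ^ ν :=
    eventually_mul_rpow_le_mul_rpow _ hν' hε
  filter_upwards [H2, E1, E2, E3, E4, eventually_ge_atTop 2] with D hP hE1 hE2 hE3 hE4 hD2
  obtain ⟨P, hP0, hPdeg, hPht, hPval⟩ := hP
  set N : ℕ := D / 2 with hN
  have hDpos : (0 : ℝ) < D := by exact_mod_cast (show 0 < D by omega)
  have hND : (N : ℝ) ≤ D := by exact_mod_cast Nat.div_le_self D 2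
  have hN3 : (D : ℝ) / 3 ≤ N := by
    rw [div_le_iff₀ (by norm_num : (0 : ℝ) < 3)]
    exact_mod_cast (show D ≤ D / 2 * 3 by omega)
  have hNpos : (0 : ℝ) < N := lt_of_lt_of_le (by positivity) hN3
  refine ⟨revX2 N P, revX2_ne_zero hPdeg hP0, (totalDegree_revX2_le hPdeg).trans (by omega),
    ?_, ?_⟩
  · -- height
    calc (mvPolyHeight (revX2 N P) : ℝ) ≤ mvPolyHeight P := by
          exact_mod_cast mvPolyHeight_revX2_le hPdeg
      _ ≤ Real.exp ((N : ℝ) ^ β) := hPht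
      _ ≤ Real.exp ((D : ℝ) ^ β) :=
          Real.exp_le_exp.mpr (Real.rpow_le_rpow (Nat.cast_nonneg _) hND hβ)
  · -- values
    intro i hi
    -- `D^{σ'} ≤ N^σ`, so the hypothesis applies at `i`
    have hpow : (D : ℝ) ^ σ' ≤ (N : ℝ) ^ σ := by
      have hσ0 : 0 ≤ σ := hσ'0.trans hσ'.le
      have h3 : (0 : ℝ) < 3 ^ σ := by positivity
      calc (D : ℝ) ^ σ' = (3 ^ σ)⁻¹ * (3 ^ σ * (D : ℝ) ^ σ') := by
            rw [← mul_assoc, inv_mul_cancel₀ h3.ne', one_mul]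
        _ ≤ (3 ^ σ)⁻¹ * (D : ℝ) ^ σ := by
            refine mul_le_mul_of_nonneg_left ?_ (inv_nonneg.mpr h3.le)
            rwa [one_mul] at hE1
        _ = ((D : ℝ) / 3) ^ σ := by
            rw [Real.div_rpow hDpos.le (by norm_num), div_eq_inv_mul]
        _ ≤ (N : ℝ) ^ σ := Real.rpow_le_rpow (by positivity) hN3 hσ0
    have hi' : i < 4 * ⌊(N : ℝ) ^ σ⌋₊ :=
      lt_of_lt_of_le hi (Nat.mul_le_mul_left 4 (Nat.floor_le_floor hpow))
    have hv := hPval i hi'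
    -- the point `(ξ + ir, η⁻¹ s⁻ⁱ)`
    set y : ℂ := η⁻¹ * ((s⁻¹ : ℚ) : ℂ) ^ i with hy
    have hy' : y = (η * (s : ℂ) ^ i)⁻¹ := by
      rw [hy, Rat.cast_inv, mul_inv, inv_pow]
    have hw0 : η * (s : ℂ) ^ i ≠ 0 := mul_ne_zero hη (pow_ne_zero _ hs0')
    have hy0 : y ≠ 0 := by rw [hy']; exact inv_ne_zero hw0
    rw [aeval_revX2 hPdeg _ _ hy0, norm_mul, norm_pow, hy', inv_inv]
    -- size of the scalar factor
    have hwn : 0 < ‖(η * (s : ℂ) ^ i)⁻¹‖ := norm_pos_iff.mpr (inv_ne_zero hw0)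
    have hlog : Real.log ‖(η * (s : ℂ) ^ i)⁻¹‖ ≤ A + i * B := by
      rw [norm_inv, Real.log_inv, norm_mul, norm_pow, Real.log_mul (norm_ne_zero_iff.mpr hη)
        (pow_ne_zero _ (norm_ne_zero_iff.mpr hs0')), Real.log_pow, hsn, neg_add]
      refine add_le_add (neg_le_abs _) (le_of_eq ?_)
      rw [hB]; ring
    have hi4 : (i : ℝ) ≤ 4 * (D : ℝ) ^ σ' := by
      have h1 : (i : ℝ) ≤ ((4 * ⌊(D : ℝ) ^ σ'⌋₊ : ℕ) : ℝ) := by exact_mod_cast hi.le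
      refine h1.trans ?_
      push_cast
      exact mul_le_mul_of_nonneg_left (Nat.floor_le (Real.rpow_nonneg hDpos.le _)) (by norm_num)
    have hscal : ‖(η * (s : ℂ) ^ i)⁻¹‖ ^ N ≤
        Real.exp ((D : ℝ) * A + 4 * B * (D : ℝ) ^ (1 + σ')) := by
      rw [← Real.rpow_natCast, Real.rpow_def_of_pos hwn, Real.exp_le_exp]
      have hAB : 0 ≤ A + i * B := by positivity
      calc Real.log ‖(η * (s : ℂ) ^ i)⁻¹‖ * N ≤ (A + i * B) * N :=
            mul_le_mul_of_nonneg_right hlog (Nat.cast_nonneg _)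
        _ ≤ (A + 4 * (D : ℝ) ^ σ' * B) * D := by
            refine mul_le_mul ?_ hND (Nat.cast_nonneg _) (by positivity)
            exact add_le_add le_rfl (mul_le_mul_of_nonneg_right hi4 hB0.le)
        _ = (D : ℝ) * A + 4 * B * ((D : ℝ) ^ σ' * D) := by ring
        _ = (D : ℝ) * A + 4 * B * (D : ℝ) ^ (1 + σ') := by
            rw [add_comm (1 : ℝ) σ', Real.rpow_add hDpos, Real.rpow_one]
    -- conclusion
    have hmain : (D : ℝ) * A + 4 * B * (D : ℝ) ^ (1 + σ') - (N : ℝ) ^ ν ≤ -(D : ℝ) ^ ν' := by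
      rw [Real.rpow_one] at hE2
      rw [one_mul] at hE4
      have h3 : 3 * (1 / 3 ^ (ν + 1) * (D : ℝ) ^ ν) = ((D : ℝ) / 3) ^ ν := by
        rw [Real.div_rpow hDpos.le (by norm_num), Real.rpow_add (by norm_num : (0 : ℝ) < 3),
          Real.rpow_one]
        field_simp
      have h4 : ((D : ℝ) / 3) ^ ν ≤ (N : ℝ) ^ ν := Real.rpow_le_rpow (by positivity) hN3 hν0.le
      nlinarith [hE2, hE3, hE4, h3, h4]
    calc ‖(η * (s : ℂ) ^ i)⁻¹‖ ^ N * ‖aeval ![ξ + (i : ℂ) * (r : ℂ), η * (s : ℂ) ^ i] P‖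
        ≤ Real.exp ((D : ℝ) * A + 4 * B * (D : ℝ) ^ (1 + σ')) * Real.exp (-(N : ℝ) ^ ν) :=
          mul_le_mul hscal hv (norm_nonneg _) (Real.exp_pos _).le
      _ = Real.exp ((D : ℝ) * A + 4 * B * (D : ℝ) ^ (1 + σ') - (N : ℝ) ^ ν) := by
          rw [← Real.exp_add, sub_eq_add_neg]
      _ ≤ Real.exp (-(D : ℝ) ^ ν') := Real.exp_le_exp.mpr hmain

/-! ### Openness of condition (1) -/

/-- **Condition (1) of Theorem 1 is open in `(σ, ν)` for `σ > 1`**: if `1 < σ < 2`, `σ + 1 < β` and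
`ν` satisfies (1), there are `1 ≤ σ' < σ` and `ν' < ν` with `1 + σ' < ν'` satisfying (1) as
well. [cite: NguyenRoy2016, Theorem 1 (condition (1)) and proof of Lemma 3 ("we choose ε > 0 sufficiently small so that the condition (1) still holds")] -/
theorem exists_smaller_params {σ β ν : ℝ} (h1 : 1 < σ) (h2 : σ < 2) (hβ : σ + 1 < β)
    (hν1 : 3 / 2 ≤ σ → 2 + β - σ < ν)
    (hν2 : σ < 3 / 2 → 2 + β - σ + (σ - 1) * (3 - 2 * σ) / (2 + β - 2 * σ) < ν) :
    ∃ σ' ν' : ℝ, 1 ≤ σ' ∧ σ' < σ ∧ ν' < ν ∧ 1 + σ' < ν' ∧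
      (3 / 2 ≤ σ' → 2 + β - σ' < ν') ∧
      (σ' < 3 / 2 → 2 + β - σ' + (σ' - 1) * (3 - 2 * σ') / (2 + β - 2 * σ') < ν') := by
  by_cases hσ : 3 / 2 < σ
  · -- first regime: explicit choice
    have hlt : 2 + β - σ < ν := hν1 hσ.le
    set δ : ℝ := (ν - (2 + β - σ)) / 4 with hδ
    have hδ0 : 0 < δ := by rw [hδ]; linarith
    refine ⟨max (3 / 2) (σ - δ), (2 + β - σ + ν) / 2, ?_, ?_, by linarith, ?_, ?_, ?_⟩
    · exact le_trans (by norm_num) (le_max_left _ _)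
    · exact max_lt hσ (by linarith)
    · have : max (3 / 2) (σ - δ) < σ := max_lt hσ (by linarith)
      linarith
    · intro _
      have : σ - δ ≤ max (3 / 2) (σ - δ) := le_max_right _ _
      linarith
    · intro h
      exact absurd (le_max_left (3 / 2 : ℝ) (σ - δ)) (not_le.mpr h)
  · -- `σ ≤ 3/2`: continuity of the second-branch function at `σ`
    push Not at hσ
    set F : ℝ → ℝ := fun t => 2 + β - t + (t - 1) * (3 - 2 * t) / (2 + β - 2 * t) with hF
    have hFσ : F σ < ν := by
      rcases hσ.lt_or_eq with hlt | heq
      · exact hν2 hlt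
      · have h0 : (σ - 1) * (3 - 2 * σ) / (2 + β - 2 * σ) = 0 := by
          rw [heq]; norm_num
        show 2 + β - σ + (σ - 1) * (3 - 2 * σ) / (2 + β - 2 * σ) < ν
        rw [h0, add_zero]
        exact hν1 heq.ge
    have hden : 2 + β - 2 * σ ≠ 0 := by linarith
    have hcont : ContinuousAt F σ := by
      have h1c : ContinuousAt (fun t : ℝ => (t - 1) * (3 - 2 * t) / (2 + β - 2 * t)) σ :=
        ContinuousAt.div (by fun_prop) (by fun_prop) hden
      exact ((continuousAt_const.sub continuousAt_id).add h1c)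
    set ν' : ℝ := (F σ + ν) / 2 with hν'
    have hν'lt : F σ < ν' := by rw [hν']; linarith
    have hev1 : ∀ᶠ t in 𝓝 σ, F t < ν' := hcont.eventually_lt continuousAt_const hν'lt
    have hev2 : ∀ᶠ t in 𝓝[<] σ, 1 < t ∧ t < σ := by
      filter_upwards [Ioo_mem_nhdsLT h1] with t ht
      exact ⟨ht.1, ht.2⟩
    obtain ⟨t, ⟨ht1, htσ⟩, hFt⟩ := (hev2.and (hev1.filter_mono nhdsWithin_le_nhds)).exists
    have hFge : 2 + β - σ ≤ F σ := by
      show 2 + β - σ ≤ 2 + β - σ + (σ - 1) * (3 - 2 * σ) / (2 + β - 2 * σ)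
      have : 0 ≤ (σ - 1) * (3 - 2 * σ) / (2 + β - 2 * σ) :=
        div_nonneg (mul_nonneg (by linarith) (by linarith)) (by linarith)
      linarith
    refine ⟨t, ν', ht1.le, htσ, by linarith, by linarith, ?_, fun _ => hFt⟩
    intro h
    exact absurd (lt_of_lt_of_le htσ hσ) (not_lt.mpr h)

/-! ### Lemma 3 (for `1 < σ < 2`) -/

/-- **Nguyen–Roy 2016, Lemma 3** (for `1 < σ < 2`). Suppose that the statement of Theorem 1
holds whenever `|s| > 1`. Then it holds for every `s ∈ ℚ ∖ {0, ±1}` and every `1 < σ < 2`: for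
`|s| < 1` apply the case `|s⁻¹| > 1` to `(ξ, η⁻¹, r, s⁻¹)` with the parameters `(σ', β, ν')` of
`exists_smaller_params` and the polynomials `X₂^{⌊D/2⌋} P_{⌊D/2⌋}(X₁, X₂⁻¹)` (`smallValue_hyp_inv`);
`ξ` and `η⁻¹`, hence `η`, are algebraic. (The boundary `σ = 1`, `|s| < 1` is not covered — see the
module docstring.) [cite: NguyenRoy2016, Lemma 3] -/
theorem thm1_of_one_lt_abs
    (H : ∀ (ξ η : ℂ), η ≠ 0 → ∀ (r s : ℚ), r ≠ 0 → 1 < |s| →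
      ∀ (σ β ν : ℝ), 1 ≤ σ → σ < 2 → σ + 1 < β →
      (3 / 2 ≤ σ → 2 + β - σ < ν) →
      (σ < 3 / 2 → 2 + β - σ + (σ - 1) * (3 - 2 * σ) / (2 + β - 2 * σ) < ν) →
      (∀ᶠ D : ℕ in atTop, ∃ P : MvPolynomial (Fin 2) ℤ, P ≠ 0 ∧ P.totalDegree ≤ D ∧
        (mvPolyHeight P : ℝ) ≤ Real.exp ((D : ℝ) ^ β) ∧
        ∀ i : ℕ, i < 4 * ⌊(D : ℝ) ^ σ⌋₊ →
          ‖aeval ![ξ + (i : ℂ) * (r : ℂ), η * (s : ℂ) ^ i] P‖ ≤ Real.exp (-(D : ℝ) ^ ν)) →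
      IsAlgebraic ℚ ξ ∧ IsAlgebraic ℚ η)
    (ξ η : ℂ) (hη : η ≠ 0) (r s : ℚ) (hr : r ≠ 0) (hs0 : s ≠ 0) (hs1 : s ≠ 1) (hs2 : s ≠ -1)
    (σ β ν : ℝ) (h1 : 1 < σ) (h2 : σ < 2) (hβ : σ + 1 < β)
    (hν1 : 3 / 2 ≤ σ → 2 + β - σ < ν)
    (hν2 : σ < 3 / 2 → 2 + β - σ + (σ - 1) * (3 - 2 * σ) / (2 + β - 2 * σ) < ν)
    (hyp : ∀ᶠ D : ℕ in atTop, ∃ P : MvPolynomial (Fin 2) ℤ, P ≠ 0 ∧ P.totalDegree ≤ D ∧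
      (mvPolyHeight P : ℝ) ≤ Real.exp ((D : ℝ) ^ β) ∧
      ∀ i : ℕ, i < 4 * ⌊(D : ℝ) ^ σ⌋₊ →
        ‖aeval ![ξ + (i : ℂ) * (r : ℂ), η * (s : ℂ) ^ i] P‖ ≤ Real.exp (-(D : ℝ) ^ ν)) :
    IsAlgebraic ℚ ξ ∧ IsAlgebraic ℚ η := by
  have habs : |s| ≠ 1 := by
    intro h
    rcases (abs_eq zero_le_one).mp h with h' | h'
    · exact hs1 h'
    · exact hs2 h'
  rcases habs.lt_or_gt with hlt | hgt
  · -- `|s| < 1`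
    obtain ⟨σ', ν', h1', hσ', hν', hgap, hc1, hc2⟩ := exists_smaller_params h1 h2 hβ hν1 hν2
    have H' := smallValue_hyp_inv hη hs0 hlt (by linarith) hσ' (by linarith) hgap hν' hyp
    have hinv : 1 < |s⁻¹| := by
      rw [abs_inv, one_lt_inv₀ (abs_pos.mpr hs0)]
      exact hlt
    have h := H ξ η⁻¹ (inv_ne_zero hη) r s⁻¹ hr hinv σ' β ν' h1' (by linarith) (by linarith)
      hc1 hc2 H'
    refine ⟨h.1, ?_⟩
    have := h.2.inv
    rwa [inv_inv] at this
  · exact H ξ η hη r s hr hgt σ β ν h1.le h2 hβ hν1 hν2 hyp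

end NguyenRoy

end Literature.NumberTheory.Transcendental
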